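import Mathlib
import Summits.NavierStokesRegularity.NavierStokesRegularity.Theorems.DssFarFieldSlavingBlowupTypeIDssProfileGaussianSignCoherentTypeI
import HarnessLib

/-!
# E33 (pointwise form) and E33-MEAN (period-mean form) are EMPTY at CLASS level (pub-ns-dss theory
  T42 / row E33, E33-CLASS-BRIDGE v1.2 (C2)–(C4)/(S1)–(S3), NULL-TESTS n21; route `DssFarFieldSlaving`,
  crux `BlowupTypeIDssProfile`,
  stmt-NavierStokesRegularity-0155 — SUPPORT; cell pub-ns-dss, typer seat g5, 2026-08-23; imports the
  classical-level file `…GaussianSignCoherentTypeI.lean`)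

HONEST FRAMING. A Liouville statement for a SLICE of the hypothesis class of
`Theses.FilamentSkeletonRss.RdssProfileTruncation` (H0 `1 < c`, H5 ancient mild `ν = 1`, H4 measurable
slices, H2 rotated `c`-DSS with the Pineau–Vicol twist convention `IsRotatedDSS c (rotZLIE (−θ)) u`,
H3 `HasTypeIDecay M u`, H6 non-trivial) cut by a SIGN CONDITION (POINTWISE, or in PERIOD MEAN) on
the co-rotating similarity profile of every Type-I representative — an empty slice is a census ghost
index (C13 D-6), never a discard; nothing here bears on Navier–Stokes regularity or blow-up. Nothing is
numeric.

THE CELL (E33-CLASS-BRIDGE v1.2 (S3), binder for binder). For a Type-I representative `V` of the member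
(`IsTypeIAncientMild M V`, `V t = u t` a.e. for `t < 0`; representatives quantified universally, as in
the E24/E27/E32 wrappers) put `α = θ / (2 log c)`, `U(y, s) = R_{−αs} (lerayOrbit V s)(R_{αs} y)`
(`R_θ = rotZ θ`) and `P(y, s) = e^{−s} Q[V(−e^{−s})](e^{−s/2} R_{αs} y)`, `Q = pressurePotential` the
normalised (Calderón–Zygmund) pressure of the slice (Tao 2011 (35)); the cell is
`0 ≤ ⟪y, U(y,s)⟫ (½|U(y,s)|² + P(y,s))` for all `y, s`. THE GAUGE IS NAMED: the hypothesis is stated for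
THIS `P` and is NOT invariant under `P ↦ P + c(s)` (it shifts by `c(s)⟪y, U⟫`, of no sign). The
equivalent form with the pressure written as the potential OF THE SIMILARITY SLICE,
`P(y, s) = Q[lerayOrbit V s](R_{αs} y)` (`GaussianHeadPressure.exp_mul_pressurePotential_eq`), is
`rdssClass_signCoherent_ae_zero'`.

THE THEOREMS: `rdssClass_signCoherent_ae_zero` (Liouville form), `rdssClass_signCoherent_ae_zero'`
(slice-potential form), `rdssClass_signCoherent_empty` (empty-cell form, pattern of
`GaussianGap.rdssClass_gaussianGap_empty`); and the PERIOD-MEAN forms `rdssClass_meanSignCoherent_ae_zero`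
/ `rdssClass_meanSignCoherent_empty` (E33-MEAN, NULL-TESTS n21: the single inequality
`0 ≤ ∫₀^{2 log c} ∫ γ ⟪y,U⟫(½|U|² + P + ½⟪y,U⟫)` on every representative — the census's operational ghost
criterion, implied by the pointwise form). PROOF: classical representative at the same `(c, θ, M)`
(`rdssClass_classicalRepresentative`) and the classical-level theorems
`GaussianHeadPressure.typeI_rdss_signCoherent_eq_zero` / `typeI_rdss_meanSignCoherent_eq_zero`.
LABELS: «E33 POINTWISE cell EMPTY at CLASS level», «E33-MEAN cell EMPTY at CLASS level».
[this file; theory T42/E33 + E33-CLASS-BRIDGE v1.2 (C4)]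
-/

noncomputable section

set_option linter.dupNamespace false

namespace Summit.NavierStokesRegularity.NavierStokesRegularity.Theorems.GaussianHeadPressure

open Set Function Filter MeasureTheory InnerProductSpace Metric
open scoped RealInnerProductSpace Laplacian ContDiff Topology BigOperators
open Literature.Analysis Literature.Analysis.FluidPDE Literature.Analysis.FluidPDE.PineauVicol2026
open Summit.NavierStokesRegularity.NavierStokesRegularity.Theorems

/-- **Every continuous-slice representative of a Type-I class member obeys the Type-I bound
everywhere**: if `‖u(t,x)‖ ≤ M/(‖x‖ + √(−t))` for all `t < 0`, `x`, the slices `V t` (`t < 0`) are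
continuous and `V t = u t` a.e., then `HasTypeIDecay M V` (a continuous function which is `≤ 0` a.e.
is `≤ 0` everywhere: Lebesgue measure charges open sets). [folklore] -/
theorem hasTypeIDecay_of_slice_ae_eq {M : ℝ} {u V : ℝ → EuclideanSpace ℝ (Fin 3) → EuclideanSpace ℝ (Fin 3)}
    (hdec : HasTypeIDecay M u) (hVc : ∀ t < 0, Continuous (V t))
    (hVu : ∀ t < 0, V t =ᵐ[volume] u t) : HasTypeIDecay M V := by
  intro t ht x
  have hden : ∀ z : EuclideanSpace ℝ (Fin 3), 0 < ‖z‖ + Real.sqrt (-t) := fun z =>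
    add_pos_of_nonneg_of_pos (norm_nonneg z) (Real.sqrt_pos.2 (by linarith))
  set g : EuclideanSpace ℝ (Fin 3) → ℝ := fun z => max (‖V t z‖ - M / (‖z‖ + Real.sqrt (-t))) 0
    with hg
  have hgc : Continuous g := by
    refine Continuous.max (((hVc t ht).norm).sub (continuous_const.div
      (continuous_norm.add continuous_const) fun z => (hden z).ne')) continuous_const
  have hae : g =ᵐ[volume] fun _ => (0 : ℝ) := by
    filter_upwards [hVu t ht] with z hz
    simp only [hg, hz]
    exact max_eq_right (by linarith [hdec t ht z])
  have h0 : g x = 0 := congrFun ((hgc.ae_eq_iff_eq (μ := volume) continuous_const).mp hae) x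
  have h2 : max (‖V t x‖ - M / (‖x‖ + Real.sqrt (-t))) 0 = 0 := by simpa only [hg] using h0
  have h1 : ‖V t x‖ - M / (‖x‖ + Real.sqrt (-t)) ≤ 0 := (le_max_left _ _).trans h2.le
  linarith

/-- **E33 (pointwise form) at CLASS level — Liouville form** (E33-CLASS-BRIDGE v1.2 (S3), binder for
binder). Let `u` be an ancient mild solution (`ν = 1`) with measurable slices, rotated `c`-DSS with twist
`R_{−θ}` (`IsRotatedDSS c (rotZLIE (−θ)) u`, `1 < c`) and Type-I bound `HasTypeIDecay M u`; put
`α = θ / (2 log c)`. If for EVERY Type-I representative `V` (`IsTypeIAncientMild M V`, `V t = u t` a.e. for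
`t < 0`) the co-rotating similarity profile `U(y,s) = R_{−αs}(lerayOrbit V s)(R_{αs} y)` and the
transported Calderón–Zygmund pressure `P(y,s) = e^{−s} Q[V(−e^{−s})](e^{−s/2} R_{αs} y)` satisfy
`0 ≤ ⟪y, U(y,s)⟫ (½|U(y,s)|² + P(y,s))` for all `s, y`, then `u(t) = 0` a.e. for every `t < 0`.
The hypothesis is stated with the normalised (Calderón–Zygmund) pressure and is gauge-dependent by
nature. Proof: `rdssClass_classicalRepresentative` + `typeI_rdss_signCoherent_eq_zero`.
[this file; theory T42/E33 + E33-CLASS-BRIDGE v1.2 (C2)–(C4)] -/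
theorem rdssClass_signCoherent_ae_zero {M c θ : ℝ}
    {u : ℝ → EuclideanSpace ℝ (Fin 3) → EuclideanSpace ℝ (Fin 3)} (hc : 1 < c)
    (hu : IsAncientMildSolution 1 u) (hmeas : ∀ t < 0, AEStronglyMeasurable (u t) volume)
    (hdss : IsRotatedDSS c (rotZLIE (-θ)) u) (hdec : HasTypeIDecay M u)
    (hsign : ∀ V : ℝ → EuclideanSpace ℝ (Fin 3) → EuclideanSpace ℝ (Fin 3), IsTypeIAncientMild M V →
      (∀ t < 0, V t =ᵐ[volume] u t) →
      ∀ (s : ℝ) (y : EuclideanSpace ℝ (Fin 3)),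
        0 ≤ ⟪y, rotZ (-(θ / (2 * Real.log c) * s))
              (lerayOrbit V s (rotZ (θ / (2 * Real.log c) * s) y))⟫ *
          (2⁻¹ * ‖rotZ (-(θ / (2 * Real.log c) * s))
              (lerayOrbit V s (rotZ (θ / (2 * Real.log c) * s) y))‖ ^ 2 +
            Real.exp (-s) * pressurePotential (V (-Real.exp (-s)))
              (Real.exp (-s / 2) • rotZ (θ / (2 * Real.log c) * s) y))) :
    ∀ t < 0, u t =ᵐ[volume] 0 := by
  obtain ⟨V, P₀, hT, -, hR, hVdec, hVu, -⟩ := rdssClass_classicalRepresentative hc hu hmeas hdss hdec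
  have hz : ∀ t < 0, ∀ x, V t x = 0 :=
    typeI_rdss_signCoherent_eq_zero hc hT hR hVdec (hsign V hT hVu)
  intro t ht
  have hVt : V t = 0 := funext fun x => by simpa using hz t ht x
  exact (hVu t ht).symm.trans (Filter.EventuallyEq.of_eq hVt)

/-- **E33 at CLASS level with the pressure written as the potential of the similarity slice**,
`P(y, s) = Q[lerayOrbit V s](R_{αs} y)`: the same theorem (every Type-I representative has the Type-I
space–time bound everywhere, `hasTypeIDecay_of_slice_ae_eq`, so the two pressures agree by
`exp_mul_pressurePotential_eq`). [this file; theory T42/E33 + E33-CLASS-BRIDGE v1.2 (C2)] -/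
theorem rdssClass_signCoherent_ae_zero' {M c θ : ℝ}
    {u : ℝ → EuclideanSpace ℝ (Fin 3) → EuclideanSpace ℝ (Fin 3)} (hc : 1 < c)
    (hu : IsAncientMildSolution 1 u) (hmeas : ∀ t < 0, AEStronglyMeasurable (u t) volume)
    (hdss : IsRotatedDSS c (rotZLIE (-θ)) u) (hdec : HasTypeIDecay M u)
    (hsign : ∀ V : ℝ → EuclideanSpace ℝ (Fin 3) → EuclideanSpace ℝ (Fin 3), IsTypeIAncientMild M V →
      (∀ t < 0, V t =ᵐ[volume] u t) →
      ∀ (s : ℝ) (y : EuclideanSpace ℝ (Fin 3)),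
        0 ≤ ⟪y, rotZ (-(θ / (2 * Real.log c) * s))
              (lerayOrbit V s (rotZ (θ / (2 * Real.log c) * s) y))⟫ *
          (2⁻¹ * ‖rotZ (-(θ / (2 * Real.log c) * s))
              (lerayOrbit V s (rotZ (θ / (2 * Real.log c) * s) y))‖ ^ 2 +
            pressurePotential (lerayOrbit V s) (rotZ (θ / (2 * Real.log c) * s) y))) :
    ∀ t < 0, u t =ᵐ[volume] 0 := by
  refine rdssClass_signCoherent_ae_zero hc hu hmeas hdss hdec fun V hT hVu s y => ?_
  have hVdec : HasTypeIDecay M V :=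
    hasTypeIDecay_of_slice_ae_eq hdec (fun t ht => hT.continuous_slice ht) hVu
  have ht : -Real.exp (-s) < 0 := neg_neg_of_pos (Real.exp_pos _)
  have hV2 : ContDiff ℝ 2 (V (-Real.exp (-s))) := (hT.contDiff_slice ht).of_le (by norm_cast)
  rw [exp_mul_pressurePotential_eq hVdec s hV2]
  exact hsign V hT hVu s y

/-- **E33 in PERIOD-MEAN form (E33-MEAN, NULL-TESTS n21) at CLASS level — Liouville form.** Same class
as `rdssClass_signCoherent_ae_zero`; the pointwise sign condition on every Type-I representative is
replaced by the single inequality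
`0 ≤ ∫₀^{2 log c} ∫ γ(y) ⟪y, U(y,s)⟫ (½|U(y,s)|² + P(y,s) + ½⟪y, U(y,s)⟫) dy ds` (`γ = gaussWeight`,
`U`, `P` as there: co-rotating similarity profile and transported Calderón–Zygmund pressure; unlike
the pointwise form this hypothesis is GAUGE INVARIANT — a per-slice pressure constant drops out since
`∫γ⟪y,U⟫ = 2∫γ div U = 0`). This is the census's operational ghost criterion (sign of the
Gaussian radial-flux pairing over one period), implied by the pointwise form. NOT JUNK-SATISFIABLE
on the class: for every Type-I representative the slice integrand is integrable for every `s` and the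
slice integral is continuous in `s` (hypothesis package `typeI_rdss_corotatingProfile_hypotheses` +
`integrable_gaussWeight_mul_inner_mul_headPressure` + (E_G)), so `∫₀^{2 log c} ∫ …` is the honest
iterated integral; equivalently, the theorem says that every NON-TRIVIAL member has a well-defined,
strictly NEGATIVE period mean. Proof: `rdssClass_classicalRepresentative` +
`typeI_rdss_meanSignCoherent_eq_zero`.
[this file; theory T42/E33, NULL-TESTS n21 (E33-MEAN, DERIVED ×2); typer] -/
theorem rdssClass_meanSignCoherent_ae_zero {M c θ : ℝ}
    {u : ℝ → EuclideanSpace ℝ (Fin 3) → EuclideanSpace ℝ (Fin 3)} (hc : 1 < c)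
    (hu : IsAncientMildSolution 1 u) (hmeas : ∀ t < 0, AEStronglyMeasurable (u t) volume)
    (hdss : IsRotatedDSS c (rotZLIE (-θ)) u) (hdec : HasTypeIDecay M u)
    (hmean : ∀ V : ℝ → EuclideanSpace ℝ (Fin 3) → EuclideanSpace ℝ (Fin 3), IsTypeIAncientMild M V →
      (∀ t < 0, V t =ᵐ[volume] u t) →
      0 ≤ ∫ s in (0 : ℝ)..(2 * Real.log c), ∫ y : EuclideanSpace ℝ (Fin 3), gaussWeight y *
        (⟪y, rotZ (-(θ / (2 * Real.log c) * s))
              (lerayOrbit V s (rotZ (θ / (2 * Real.log c) * s) y))⟫ *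
          (2⁻¹ * ‖rotZ (-(θ / (2 * Real.log c) * s))
              (lerayOrbit V s (rotZ (θ / (2 * Real.log c) * s) y))‖ ^ 2 +
            Real.exp (-s) * pressurePotential (V (-Real.exp (-s)))
              (Real.exp (-s / 2) • rotZ (θ / (2 * Real.log c) * s) y) +
            1 / 2 * ⟪y, rotZ (-(θ / (2 * Real.log c) * s))
              (lerayOrbit V s (rotZ (θ / (2 * Real.log c) * s) y))⟫))) :
    ∀ t < 0, u t =ᵐ[volume] 0 := by
  obtain ⟨V, P₀, hT, -, hR, hVdec, hVu, -⟩ := rdssClass_classicalRepresentative hc hu hmeas hdss hdec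
  have hz : ∀ t < 0, ∀ x, V t x = 0 :=
    typeI_rdss_meanSignCoherent_eq_zero hc hT hR hVdec (hmean V hT hVu)
  intro t ht
  have hVt : V t = 0 := funext fun x => by simpa using hz t ht x
  exact (hVu t ht).symm.trans (Filter.EventuallyEq.of_eq hVt)

/-- **E33-MEAN: the period-mean sign-coherent cell of the hypothesis class of `RdssProfileTruncation`
is EMPTY at CLASS level** (pattern of `GaussianGap.rdssClass_gaussianGap_empty`; Pineau–Vicol twist
convention, `α = θ/(2 log c)`): for every Type-I bound `M` there is no member all of whose Type-I
representatives have non-negative period mean `∫₀^{2 log c} ∫ γ ⟪y, U⟫(½|U|² + P + ½⟪y,U⟫)` (`P` the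
transported Calderón–Zygmund pressure; the period mean is gauge invariant) and which is not a.e. zero. An empty cell is a
census ghost index, never a discard; nothing here bears on Navier–Stokes regularity.
[this file; theory T42/E33, NULL-TESTS n21 (E33-MEAN); typer] -/
theorem rdssClass_meanSignCoherent_empty (M : ℝ) :
    ¬ ∃ (c θ : ℝ) (u : ℝ → EuclideanSpace ℝ (Fin 3) → EuclideanSpace ℝ (Fin 3)),
      1 < c ∧ IsAncientMildSolution 1 u ∧ (∀ t < 0, AEStronglyMeasurable (u t) volume) ∧
      IsRotatedDSS c (rotZLIE (-θ)) u ∧ HasTypeIDecay M u ∧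
      (∀ V : ℝ → EuclideanSpace ℝ (Fin 3) → EuclideanSpace ℝ (Fin 3), IsTypeIAncientMild M V →
        (∀ t < 0, V t =ᵐ[volume] u t) →
        0 ≤ ∫ s in (0 : ℝ)..(2 * Real.log c), ∫ y : EuclideanSpace ℝ (Fin 3), gaussWeight y *
          (⟪y, rotZ (-(θ / (2 * Real.log c) * s))
                (lerayOrbit V s (rotZ (θ / (2 * Real.log c) * s) y))⟫ *
            (2⁻¹ * ‖rotZ (-(θ / (2 * Real.log c) * s))
                (lerayOrbit V s (rotZ (θ / (2 * Real.log c) * s) y))‖ ^ 2 +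
              Real.exp (-s) * pressurePotential (V (-Real.exp (-s)))
                (Real.exp (-s / 2) • rotZ (θ / (2 * Real.log c) * s) y) +
              1 / 2 * ⟪y, rotZ (-(θ / (2 * Real.log c) * s))
                (lerayOrbit V s (rotZ (θ / (2 * Real.log c) * s) y))⟫))) ∧
      ¬ (∀ t < 0, u t =ᵐ[volume] 0) := by
  rintro ⟨c, θ, u, hc, hu, hmeas, hdss, hdec, hmean, hne⟩
  exact hne (rdssClass_meanSignCoherent_ae_zero hc hu hmeas hdss hdec hmean)

/-- **E33 (pointwise form): the sign-coherent cell of the hypothesis class of `RdssProfileTruncation`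
is EMPTY at CLASS level** (pattern of `GaussianGap.rdssClass_gaussianGap_empty`, Pineau–Vicol twist
convention `IsRotatedDSS c (rotZLIE (−θ)) u`, `α = θ/(2 log c)`): for every Type-I bound `M` there is
no member (`1 < c`, any `θ`) all of whose Type-I representatives satisfy the pointwise sign condition
`0 ≤ ⟪y, U⟫(½|U|² + P)` of `rdssClass_signCoherent_ae_zero` (co-rotating similarity profile `U`,
transported Calderón–Zygmund pressure `P` — a gauge-dependent hypothesis, named with that gauge) and
which is not a.e. zero. An empty cell is a census ghost index, never a discard; nothing here bears on
Navier–Stokes regularity. [this file; theory T42/E33 + E33-CLASS-BRIDGE v1.2 (C4)] -/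
theorem rdssClass_signCoherent_empty (M : ℝ) :
    ¬ ∃ (c θ : ℝ) (u : ℝ → EuclideanSpace ℝ (Fin 3) → EuclideanSpace ℝ (Fin 3)),
      1 < c ∧ IsAncientMildSolution 1 u ∧ (∀ t < 0, AEStronglyMeasurable (u t) volume) ∧
      IsRotatedDSS c (rotZLIE (-θ)) u ∧ HasTypeIDecay M u ∧
      (∀ V : ℝ → EuclideanSpace ℝ (Fin 3) → EuclideanSpace ℝ (Fin 3), IsTypeIAncientMild M V →
        (∀ t < 0, V t =ᵐ[volume] u t) →
        ∀ (s : ℝ) (y : EuclideanSpace ℝ (Fin 3)),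
          0 ≤ ⟪y, rotZ (-(θ / (2 * Real.log c) * s))
                (lerayOrbit V s (rotZ (θ / (2 * Real.log c) * s) y))⟫ *
            (2⁻¹ * ‖rotZ (-(θ / (2 * Real.log c) * s))
                (lerayOrbit V s (rotZ (θ / (2 * Real.log c) * s) y))‖ ^ 2 +
              Real.exp (-s) * pressurePotential (V (-Real.exp (-s)))
                (Real.exp (-s / 2) • rotZ (θ / (2 * Real.log c) * s) y))) ∧
      ¬ (∀ t < 0, u t =ᵐ[volume] 0) := by
  rintro ⟨c, θ, u, hc, hu, hmeas, hdss, hdec, hsign, hne⟩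
  exact hne (rdssClass_signCoherent_ae_zero hc hu hmeas hdss hdec hsign)

end Summit.NavierStokesRegularity.NavierStokesRegularity.Theorems.GaussianHeadPressure

end
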